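import Literature.AnabelianGeometry.SemiGraphs.TemperedPiDecomposition
import Literature.AnabelianGeometry.SemiGraphs.TreeSystemFixedPointTopological

/-!
# Compact subgroups of `π₁^temp` meet the deck kernel trivially ([SemiAnbd] Thm 3.7 (iii), p. 41)

Mochizuki, *Semi-graphs of anabelioids*, §3, proof of Thm. 3.7 (iii), author's manuscript p. 41
[cite: MochizukiSemiAnbd2006, Thm 3.7(iii) p.41]: a compact subgroup `H ⊆ π₁^temp(𝒢)` "acts
continuously on `𝒢_{∞,i}` … this action factors through a finite quotient … by Lemma 1.8 (ii) …
`H` fixes at least one vertex of `𝒢_{∞,i}`".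

For Galois level data `D` (abc-iut-L3-t9's tower `S n`, `π₁^temp = D.temperedPi = limₙ Aut(𝒢_{∞,S n})`)
the homomorphisms `Aut(𝒢_{∞,S n}) → Aut(S n)` (`descendBaseAut`, seat abc-iut-L3-t6 (B5b)) have kernel
the deck group `π₁(𝔾_{S n})` (`descendBaseAut_eq_one_iff`), which acts FREELY on the tree `𝔾̃_n`
(`SemiGraph.deck_vertex_eq_self_iff`).  Combining this with the fixed vertex above gives the
tower-independent fact recorded here (seat abc-iut-L3-t6, row (I0c) of the (β) contract, finding
F-t6g3-1): **an element of a COMPACT subgroup of `π₁^temp` which acts trivially on every finite level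
`S n` is trivial** (`eq_one_of_isCompact_of_descendBaseAut_proj_eq_one`), i.e. the map
`π₁^temp → ∏ₙ Aut(S n)` is injective on every compact subgroup (`injOn_of_isCompact_of_ker_le`) —
although it need not be injective (its kernel is the group of compatible deck families, which is
nontrivial when the finite levels `S n` are not cofinal among the finite étale coverings).
Proof-only; nothing here bears on [IUTchIII] Cor. 3.12.
-/

namespace Literature.AnabelianGeometry.SemiGraphs

namespace ProfiniteSemiGraph

namespace GaloisLevelData

open CategoryTheory Topology

universe u

variable {𝒢 : ProfiniteSemiGraph.{u}} (D : GaloisLevelData 𝒢) (h𝒢 : 𝒢.IsCountable)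
  (hconn : ∀ (n : ℕ) (p q : (D.S n).Point), (D.S n).SameComponent p q)

/-- **A deck transformation of `𝒢_{∞,S n} → S n` fixing a vertex of the tree `𝔾̃_n` is trivial**:
if `σ ∈ Aut(𝒢_{∞,S n})` descends to the identity of `S n` and its action on `𝔾̃_n` fixes a vertex,
then `σ = 1` (the deck group `π₁(𝔾_{S n})` acts freely on `𝔾̃_n`).
[cite: MochizukiSemiAnbd2006, Prop 3.6 p.38] -/
theorem gal_eq_one_of_descendBaseAut_eq_one_of_fixes (n : ℕ) (σ : D.Gal h𝒢 n)
    (hσ : (D.S n).descendBaseAut h𝒢 (D.W n) (D.htrans n) (hconn n) σ = 1)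
    (x : (D.tree n).Vertex) (hx : (D.galTreeAct h𝒢 n σ).hom.vertexMap x = x) : σ = 1 := by
  obtain ⟨γ, rfl⟩ := ((D.S n).descendBaseAut_eq_one_iff h𝒢 (D.W n) (D.htrans n) (hconn n) σ).mp hσ
  have hdeck : D.galTreeAct h𝒢 n ((D.S n).deckOverAut (Sum.inl (D.W n)) h𝒢 γ) =
      SemiGraph.deckAut (D.S n).orbitGraph (Sum.inl (D.W n)) γ :=
    (D.S n).autUnivCover_deckOverAut (Sum.inl (D.W n)) h𝒢 γ
  rw [hdeck] at hx
  have hγ : γ = 1 := (SemiGraph.deck_vertex_eq_self_iff (D.S n).orbitGraph (Sum.inl (D.W n)) γ x).mp hx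
  subst hγ
  exact Iso.ext ((D.S n).deckOver_one (Sum.inl (D.W n)) h𝒢)

/-- **(I0c) An element of a compact subgroup of `π₁^temp` acting trivially on every finite level
`S n` is trivial** ("this action factors through a finite quotient … `H` fixes at least one vertex of
`𝒢_{∞,i}`", p. 41, + freeness of the deck action): for `C ≤ π₁^temp` compact and `g ∈ C` with
`descendBaseAut (ρ_n g) = 1` for all `n`, `g = 1`.  Tower-independent: no cofinality of the finite
levels is needed (whereas without compactness the statement fails for non-cofinal towers, finding
F-t6g3-1). [cite: MochizukiSemiAnbd2006, Thm 3.7(iii) p.41] -/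
theorem eq_one_of_isCompact_of_descendBaseAut_proj_eq_one (C : Subgroup (D.temperedPi h𝒢))
    (hC : IsCompact (C : Set (D.temperedPi h𝒢))) (g : D.temperedPi h𝒢) (hg : g ∈ C)
    (htriv : ∀ n, (D.S n).descendBaseAut h𝒢 (D.W n) (D.htrans n) (hconn n) (D.proj h𝒢 n g) = 1) :
    g = 1 := by
  refine D.pi_ext h𝒢 fun n => ?_
  rw [map_one]
  -- the compact `C` acts on the tree `𝔾̃_n` over `𝔾` through a finite quotient, hence fixes a vertex
  obtain ⟨x, hx⟩ := SemiGraph.exists_fixed_vertex_of_isCompact_over C hC (D.isTree_tree n)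
    (D.treeVertex n) (D.treeProj n) (D.treeAct h𝒢 n) (D.isOpen_ker_treeAct h𝒢 n) (D.treeAct_over h𝒢 n)
  -- `ρ_n g` is a deck transformation fixing that vertex, hence trivial
  exact D.gal_eq_one_of_descendBaseAut_eq_one_of_fixes h𝒢 hconn n (D.proj h𝒢 n g) (htriv n) x
    (by simpa only [treeAct_apply] using hx ⟨g, hg⟩)

/-- **(I0c), subgroup form**: a compact subgroup of `π₁^temp` meets the group of compatible deck
families `⋂ₙ ker (descendBaseAut ∘ ρ_n)` trivially. [cite: MochizukiSemiAnbd2006, Thm 3.7(iii) p.41] -/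
theorem inf_iInf_ker_descendBaseAut_proj_eq_bot (C : Subgroup (D.temperedPi h𝒢))
    (hC : IsCompact (C : Set (D.temperedPi h𝒢))) :
    C ⊓ ⨅ n, (((D.S n).descendBaseAut h𝒢 (D.W n) (D.htrans n) (hconn n)).comp (D.proj h𝒢 n)).ker = ⊥ := by
  rw [eq_bot_iff]
  rintro g ⟨hg, hker⟩
  rw [Subgroup.mem_bot]
  refine D.eq_one_of_isCompact_of_descendBaseAut_proj_eq_one h𝒢 hconn C hC g hg fun n => ?_
  have := (Subgroup.mem_iInf.mp hker) n
  rwa [MonoidHom.mem_ker, MonoidHom.comp_apply] at this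

/-- **(I0c), `InjOn` form**: any homomorphism `ι : π₁^temp → Q` whose kernel consists of elements
acting trivially on every finite level `S n` (e.g. the map to `∏ₙ Aut(S n)` or to its limit) is
injective on every compact subgroup. [cite: MochizukiSemiAnbd2006, Thm 3.7(iii) p.41] -/
theorem injOn_of_isCompact_of_ker_le {Q : Type*} [Group Q] (ι : D.temperedPi h𝒢 →* Q)
    (hι : ∀ g : D.temperedPi h𝒢, ι g = 1 →
      ∀ n, (D.S n).descendBaseAut h𝒢 (D.W n) (D.htrans n) (hconn n) (D.proj h𝒢 n g) = 1)
    (C : Subgroup (D.temperedPi h𝒢)) (hC : IsCompact (C : Set (D.temperedPi h𝒢))) :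
    Set.InjOn ι (C : Set (D.temperedPi h𝒢)) := by
  intro g hg g' hg' heq
  have h1 : ι (g⁻¹ * g') = 1 := by rw [map_mul, map_inv, heq, inv_mul_cancel]
  have h2 : g⁻¹ * g' = 1 :=
    D.eq_one_of_isCompact_of_descendBaseAut_proj_eq_one h𝒢 hconn C hC (g⁻¹ * g')
      (C.mul_mem (C.inv_mem hg) hg') (hι _ h1)
  exact inv_mul_eq_one.mp h2

/-- **The family `g ↦ (descendBaseAut (ρ_n g))ₙ : π₁^temp → ∏ₙ Aut(S n)` is injective on compact
subgroups** (the case `ι` = the product map). [cite: MochizukiSemiAnbd2006, Thm 3.7(iii) p.41] -/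
theorem injOn_pi_descendBaseAut_proj_of_isCompact (C : Subgroup (D.temperedPi h𝒢))
    (hC : IsCompact (C : Set (D.temperedPi h𝒢))) :
    Set.InjOn (MonoidHom.pi fun n =>
        ((D.S n).descendBaseAut h𝒢 (D.W n) (D.htrans n) (hconn n)).comp (D.proj h𝒢 n))
      (C : Set (D.temperedPi h𝒢)) :=
  D.injOn_of_isCompact_of_ker_le h𝒢 hconn _ (fun _ hg n => congrFun hg n) C hC

end GaloisLevelData

end ProfiniteSemiGraph

end Literature.AnabelianGeometry.SemiGraphs
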